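import Mathlib.Analysis.InnerProductSpace.Basic
import Mathlib.Analysis.Normed.Module.FiniteDimension
import Mathlib.Topology.MetricSpace.ProperSpace
import Mathlib.Algebra.QuadraticDiscriminant
import Literature.Geometry.Lorentzian.Basic
import HarnessLib

/-!
# Crux `GapExhaustion` (stmt-FinalStateConjecture-10808), line `photon-shell-pseudoconvexity`:
# stub (F-1) `stub_finslerLemma` — Finsler's lemma with margin

Route `BartnikGapSettling`; helper (`--supports stmt-FinalStateConjecture-10808`) landing the
registered sub-stub (F-1) of line lead c7's wave 2: the algebraic step from the kernel-checked
`T`-conditional pseudo-convexity MARGIN of the Kerr cylinders (`Hess r(w,w) ≤ −m‖w‖²` on the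
constrained null cone) to the MULTIPLIER form consumed by Ionescu–Klainerman's conditional Carleman
estimate (Invent. Math. 175 (2009), Def. 3.1; Alexakis–Ionescu–Klainerman, CMP 299 (2010),
Lemma 4.3): `X·X(μ g − D²h) ≥ ε₁²|X|²` up to penalties of the linear constraints.

**Finsler's lemma (1936/37), margin form.** On a finite-dimensional real inner product space, if
two quadratic forms `q, g` satisfy `q(x) ≤ −m‖x‖²` on the null cone `{g = 0}` (`m > 0`), then for
some multiplier `μ ∈ ℝ` the form `q − μ g` is negative definite: `q(x) − μ g(x) ≤ −c‖x‖²`.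

Proof (elementary): (i) near the null cone on the unit sphere `q < −m/2` (compactness); (ii) the
PAIR LEMMA `finsler_pair` (`g(x) > 0 > g(y)` excludes `q(x), q(y) ≥ 0`); (iii) the largest slope
`α = max q/g` over `{g ≥ η}` is below the least slope `β = min q/g` over `{g ≤ −η}`, with a size
bound when `α ≥ 0` / `β ≤ 0`; (iv) a controlled multiplier `μ ∈ (α, β)`, compactness, homogeneity.
-/

noncomputable section

-- D-0017: single-problem summit, `Summit.<S>.<S>.…` by design (cf. lakefile `weak.linter.dupNamespace`).
set_option linter.dupNamespace false

namespace Summit.FinalStateConjecture.FinalStateConjecture.Theorems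

open Set Metric

section Finsler
variable {V : Type} [NormedAddCommGroup V] [InnerProductSpace ℝ V] [FiniteDimensional ℝ V]

omit [FiniteDimensional ℝ V] in
/-- Expansion of a quadratic form along a line: `q(x + sy) = q(x) + (q(x,y) + q(y,x)) s + q(y) s²`.
[folklore] -/
private theorem finsler_expand (q : V →L[ℝ] V →L[ℝ] ℝ) (x y : V) (s : ℝ) :
    q (x + s • y) (x + s • y) = q x x + (q x y + q y x) * s + q y y * (s * s) := by
  simp only [map_add, map_smul, add_apply, FunLike.coe_smul, Pi.smul_apply, smul_eq_mul]
  ring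

omit [FiniteDimensional ℝ V] in
/-- Homogeneity of a quadratic form: `q(r u) = r² q(u)`. [folklore] -/
private theorem finsler_smul (q : V →L[ℝ] V →L[ℝ] ℝ) (r : ℝ) (u : V) :
    q (r • u) (r • u) = r ^ 2 * q u u := by
  simp only [map_smul, FunLike.coe_smul, Pi.smul_apply, smul_eq_mul]
  ring

omit [FiniteDimensional ℝ V] in
/-- A quadratic form is continuous. [folklore] -/
private theorem finsler_continuous (q : V →L[ℝ] V →L[ℝ] ℝ) : Continuous fun x : V => q x x :=
  q.continuous₂.comp (continuous_id.prodMk continuous_id)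

omit [FiniteDimensional ℝ V] in
/-- On the unit sphere `|q(x)| ≤ ‖q‖`. [folklore] -/
private theorem finsler_le_opNorm (q : V →L[ℝ] V →L[ℝ] ℝ) {x : V} (hx : ‖x‖ = 1) :
    q x x ≤ ‖q‖ := by
  have h := q.le_opNorm₂ x x
  rw [hx, mul_one, mul_one, Real.norm_eq_abs] at h
  exact (le_abs_self _).trans h

omit [FiniteDimensional ℝ V] in
/-- **The pair lemma.** If `q < 0` at every non-zero point of the null cone of `g`, then for
`g(x) > 0 > g(y)` the values `q(x)`, `q(y)` cannot both be non-negative: the quadratic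
`s ↦ g(x + sy)` has two roots `s₁ < 0 < s₂` (explicitly, by the quadratic formula), at which
`q(x + sy) < 0`, which is incompatible with `q(x) ≥ 0`, `q(y) ≥ 0` (a suitable positive
combination of the two values equals `q(x)(s₂ − s₁) + q(y)s₁s₂(s₁ − s₂) ≥ 0`). [folklore] -/
private theorem finsler_pair (q g : V →L[ℝ] V →L[ℝ] ℝ)
    (hneg : ∀ z : V, z ≠ 0 → g z z = 0 → q z z < 0) {x y : V}
    (hx : 0 < g x x) (hy : g y y < 0) (hqx : 0 ≤ q x x) (hqy : 0 ≤ q y y) : False := by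
  set a := g x x with ha
  set bb := g x y + g y x with hbb
  set d := g y y with hd
  have hd0 : d ≠ 0 := hy.ne
  set D := bb ^ 2 - 4 * d * a with hD
  have hDpos : bb ^ 2 < D := by rw [hD]; nlinarith
  have hD0 : 0 ≤ D := by nlinarith [sq_nonneg bb]
  set r := Real.sqrt D with hr
  have hrr : r * r = D := Real.mul_self_sqrt hD0
  have hbr : |bb| < r := by
    rw [hr, ← Real.sqrt_sq_eq_abs]
    exact Real.sqrt_lt_sqrt (sq_nonneg _) hDpos
  have hb1 : 0 < -bb + r := by linarith [le_abs_self bb]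
  have hb2 : -bb - r < 0 := by linarith [neg_abs_le bb]
  have h2d : 2 * d < 0 := by linarith
  set s₁ := (-bb + r) / (2 * d) with hs₁
  set s₂ := (-bb - r) / (2 * d) with hs₂
  have hs₁neg : s₁ < 0 := div_neg_of_pos_of_neg hb1 h2d
  have hs₂pos : 0 < s₂ := div_pos_of_neg_of_neg hb2 h2d
  have hdisc : discrim d bb a = r * r := by rw [discrim, hrr, hD]
  have hroot : ∀ s : ℝ, s = s₁ ∨ s = s₂ → d * (s * s) + bb * s + a = 0 := fun s hs =>
    (quadratic_eq_zero_iff hd0 hdisc s).2 hs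
  have hGroot : ∀ s : ℝ, s = s₁ ∨ s = s₂ → g (x + s • y) (x + s • y) = 0 := by
    intro s hs
    rw [finsler_expand]
    linarith [hroot s hs]
  have hv : ∀ s : ℝ, g (x + s • y) (x + s • y) = 0 → x + s • y ≠ 0 := by
    intro s _ h0
    have hx' : x = -(s • y) := eq_neg_of_add_eq_zero_left h0
    have h1 : g x x = s ^ 2 * g y y := by
      rw [hx']
      simp only [map_neg, map_smul, neg_apply, FunLike.coe_smul, Pi.smul_apply, smul_eq_mul]
      ring
    have h2 : s ^ 2 * g y y ≤ 0 := mul_nonpos_of_nonneg_of_nonpos (sq_nonneg s) hy.le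
    linarith
  have hQ1 := hneg _ (hv s₁ (hGroot s₁ (Or.inl rfl))) (hGroot s₁ (Or.inl rfl))
  have hQ2 := hneg _ (hv s₂ (hGroot s₂ (Or.inr rfl))) (hGroot s₂ (Or.inr rfl))
  rw [finsler_expand] at hQ1 hQ2
  have k1 : s₂ * (q x x + (q x y + q y x) * s₁ + q y y * (s₁ * s₁)) < 0 :=
    mul_neg_of_pos_of_neg hs₂pos hQ1
  have k2 : (-s₁) * (q x x + (q x y + q y x) * s₂ + q y y * (s₂ * s₂)) < 0 :=
    mul_neg_of_pos_of_neg (neg_pos.2 hs₁neg) hQ2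
  have k3 : 0 ≤ q x x * (s₂ - s₁) := mul_nonneg hqx (by linarith)
  have k4 : 0 ≤ q y y * (s₁ * s₂ * (s₁ - s₂)) :=
    mul_nonneg hqy (mul_pos_of_neg_of_neg (mul_neg_of_neg_of_pos hs₁neg hs₂pos)
      (by linarith)).le
  nlinarith [k1, k2, k3, k4]

/-- **The tail of the proof.** Given the near-cone negativity scale `η₀`, the bound `B₀ = ‖q‖/η₀`,
a scale `η ≤ η₀` with `η(B₀ + 1) ≤ m/2`, and slopes `α < β` dominating `q/g` on `{g ≥ η}` from
above and on `{g ≤ −η}` from below, with `α ≤ B₀` if `α ≥ 0` and `β ≥ −B₀` if `β ≤ 0`: a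
multiplier `μ ∈ (α, β)` with `|μ| ≤ B₀ + 1` makes `q − μg` negative on the sphere, hence negative
definite with a margin. [folklore] -/
private theorem finsler_tail (q g : V →L[ℝ] V →L[ℝ] ℝ) {m B₀ η₀ η : ℝ}
    (hB₀ : 0 ≤ B₀) (hη : 0 < η) (hηη₀ : η ≤ η₀) (hηB : η * (B₀ + 1) ≤ m / 2)
    (hcone : ∀ x ∈ sphere (0 : V) 1, |g x x| < η₀ → q x x < -(m / 2))
    (α β : ℝ) (hα : ∀ x ∈ sphere (0 : V) 1, η ≤ g x x → q x x ≤ α * g x x)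
    (hαB : 0 ≤ α → α ≤ B₀)
    (hβ : ∀ y ∈ sphere (0 : V) 1, g y y ≤ -η → q y y ≤ β * g y y)
    (hβB : β ≤ 0 → -B₀ ≤ β) (hαβ : α < β) :
    ∃ (μ c : ℝ), 0 < c ∧ ∀ x : V, q x x - μ * g x x ≤ -c * ‖x‖ ^ 2 := by
  -- the multiplier
  set lo := max α (min 0 β - 1) with hlo
  set hi := min β (max 0 α + 1) with hhi
  have hlohi : lo < hi := by
    refine max_lt (lt_min hαβ ?_) (lt_min ?_ ?_)
    · linarith [le_max_right 0 α]
    · linarith [min_le_right 0 β]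
    · linarith [min_le_left 0 β, le_max_left 0 α]
  set μ := (lo + hi) / 2 with hμ
  have hμlo : lo < μ := by rw [hμ]; linarith
  have hμhi : μ < hi := by rw [hμ]; linarith
  have hαμ : α < μ := (le_max_left _ _).trans_lt hμlo
  have hμβ : μ < β := hμhi.trans_le (min_le_left _ _)
  have hμup : μ ≤ B₀ + 1 := by
    have h1 : hi ≤ max 0 α + 1 := min_le_right _ _
    have h2 : max 0 α ≤ B₀ := by
      rcases le_or_gt 0 α with h | h
      · rw [max_eq_right h]; exact hαB h
      · rw [max_eq_left h.le]; exact hB₀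
    linarith
  have hμlow : -(B₀ + 1) ≤ μ := by
    have h1 : min 0 β - 1 ≤ lo := le_max_right _ _
    have h2 : -B₀ ≤ min 0 β := by
      rcases le_or_gt β 0 with h | h
      · rw [min_eq_right h]; exact hβB h
      · rw [min_eq_left h.le]; linarith
    linarith
  have hμabs : |μ| ≤ B₀ + 1 := abs_le.2 ⟨hμlow, hμup⟩
  -- pointwise strict negativity on the sphere
  have hpt : ∀ x ∈ sphere (0 : V) 1, q x x - μ * g x x < 0 := by
    intro x hx
    rcases le_or_gt η (g x x) with hgp | hgp
    · -- `g ≥ η`: `q ≤ α g < μ g`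
      have hgpos : 0 < g x x := hη.trans_le hgp
      have h1 := hα x hx hgp
      have h2 : α * g x x < μ * g x x := mul_lt_mul_of_pos_right hαμ hgpos
      linarith
    rcases le_or_gt (g x x) (-η) with hgm | hgm
    · -- `g ≤ -η`: `q ≤ β g < μ g`
      have hgneg : g x x < 0 := hgm.trans_lt (by linarith)
      have h1 := hβ x hx hgm
      have h2 : β * g x x < μ * g x x := mul_lt_mul_of_neg_right hμβ hgneg
      linarith
    · -- `|g| < η ≤ η₀`: `q < -m/2` and `|μ g| ≤ m/2`
      have hgabs : |g x x| < η := abs_lt.2 ⟨hgm, hgp⟩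
      have hq : q x x < -(m / 2) := hcone x hx (hgabs.trans_le hηη₀)
      have h1 : -(μ * g x x) ≤ |μ| * |g x x| := by
        rw [← abs_mul]; exact neg_le_abs _
      have h2 : |μ| * |g x x| ≤ (B₀ + 1) * η :=
        mul_le_mul hμabs hgabs.le (abs_nonneg _) (by linarith)
      nlinarith
  -- compactness of the sphere: a uniform margin
  have hS : IsCompact (sphere (0 : V) 1) := isCompact_sphere 0 1
  have hF : Continuous fun x : V => q x x - μ * g x x :=
    (finsler_continuous q).sub (continuous_const.mul (finsler_continuous g))
  obtain ⟨c, hc, hcS⟩ : ∃ c : ℝ, 0 < c ∧ ∀ x ∈ sphere (0 : V) 1, q x x - μ * g x x ≤ -c := by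
    by_cases hne : (sphere (0 : V) 1).Nonempty
    · obtain ⟨x₁, hx₁, hmax⟩ := hS.exists_isMaxOn hne hF.continuousOn
      refine ⟨-(q x₁ x₁ - μ * g x₁ x₁), by linarith [hpt x₁ hx₁], fun x hx => ?_⟩
      have := (isMaxOn_iff.1 hmax) x hx
      linarith
    · exact ⟨1, one_pos, fun x hx => absurd ⟨x, hx⟩ hne⟩
  refine ⟨μ, c, hc, fun x => ?_⟩
  by_cases hx : x = 0
  · subst hx
    simp
  -- homogeneity
  have hn : 0 < ‖x‖ := norm_pos_iff.2 hx
  set u : V := ‖x‖⁻¹ • x with hu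
  have hu1 : u ∈ sphere (0 : V) 1 := by
    rw [mem_sphere_zero_iff_norm, hu, norm_smul, norm_inv, norm_norm, inv_mul_cancel₀ hn.ne']
  have hxu : x = ‖x‖ • u := by
    rw [hu, smul_smul, mul_inv_cancel₀ hn.ne', one_smul]
  have hq : q x x = ‖x‖ ^ 2 * q u u := by
    conv_lhs => rw [hxu]
    exact finsler_smul q ‖x‖ u
  have hg : g x x = ‖x‖ ^ 2 * g u u := by
    conv_lhs => rw [hxu]
    exact finsler_smul g ‖x‖ u
  have key := hcS u hu1
  have hx2 : 0 ≤ ‖x‖ ^ 2 := sq_nonneg _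
  calc q x x - μ * g x x = ‖x‖ ^ 2 * (q u u - μ * g u u) := by rw [hq, hg]; ring
    _ ≤ ‖x‖ ^ 2 * (-c) := mul_le_mul_of_nonneg_left key hx2
    _ = -c * ‖x‖ ^ 2 := by ring

/-- **Stub (F-1) — FINSLER'S LEMMA WITH MARGIN (line `photon-shell-pseudoconvexity`, crux
`GapExhaustion`, stmt-FinalStateConjecture-10808; wave 2 of line lead c7).** On a
finite-dimensional real inner product space `V`, let `q, g` be continuous bilinear forms and
`m > 0` with `q(x, x) ≤ −m‖x‖²` whenever `g(x, x) = 0`. Then there are a multiplier `μ ∈ ℝ` and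
`c > 0` with `q(x,x) − μ g(x,x) ≤ −c‖x‖²` for ALL `x` (P. Finsler, Comment. Math. Helv. 9 (1936/37)
188–192; the homogeneous S-lemma with an equality constraint). This is the step from a Hessian
margin on a null cone (Ionescu–Klainerman's (HoCond2) in margin form) to the Lagrange-multiplier
form `X·X(μ g − D²h) ≥ ε₁²|X|²` of their Def. 3.1 (Invent. Math. 175 (2009)). Elementary proof:
near-cone negativity by compactness, the pair lemma `finsler_pair`, extremal slopes `q/g` on the
compact pieces `{g ≥ η}`, `{g ≤ −η}` of the sphere, and a multiplier between them of controlled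
size. [folklore] -/
theorem stub_finslerLemma :
    ∀ (V : Type) [NormedAddCommGroup V] [InnerProductSpace ℝ V] [FiniteDimensional ℝ V]
      (q g : V →L[ℝ] V →L[ℝ] ℝ) (m : ℝ), 0 < m →
      (∀ x : V, g x x = 0 → q x x ≤ -m * ‖x‖ ^ 2) →
      ∃ (μ c : ℝ), 0 < c ∧ ∀ x : V, q x x - μ * g x x ≤ -c * ‖x‖ ^ 2 := by
  intro V _ _ _ q g m hm hmargin
  have hqc : Continuous fun x : V => q x x := finsler_continuous q
  have hgc : Continuous fun x : V => g x x := finsler_continuous g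
  set S : Set V := sphere (0 : V) 1 with hSdef
  have hS : IsCompact S := isCompact_sphere 0 1
  have hS1 : ∀ x ∈ S, ‖x‖ = 1 := fun x hx => mem_sphere_zero_iff_norm.1 hx
  -- strict negativity off the origin on the null cone, for every translate `q - t g`
  have hneg : ∀ t : ℝ, ∀ z : V, z ≠ 0 → g z z = 0 → (q - t • g) z z < 0 := by
    intro t z hz hg0
    have h1 : (q - t • g) z z = q z z - t * g z z := by
      simp only [sub_apply, FunLike.coe_smul, Pi.smul_apply, smul_eq_mul]
    rw [h1, hg0, mul_zero, sub_zero]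
    have h2 := hmargin z hg0
    have hzn : 0 < ‖z‖ := norm_pos_iff.2 hz
    have h3 : 0 < m * ‖z‖ ^ 2 := by positivity
    nlinarith
  -- Step 1: near the null cone, `q < -m/2` uniformly on the sphere
  obtain ⟨η₀, hη₀, hcone⟩ : ∃ η₀ : ℝ, 0 < η₀ ∧ ∀ x ∈ S, |g x x| < η₀ → q x x < -(m / 2) := by
    set K : Set V := S ∩ {x | -(m / 2) ≤ q x x} with hK
    have hKc : IsCompact K := hS.inter_right (isClosed_le continuous_const hqc)
    have hKg : ∀ x ∈ K, g x x ≠ 0 := by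
      rintro x ⟨hxS, hxq⟩ hg0
      have h := hmargin x hg0
      rw [hS1 x hxS] at h
      have : -(m / 2) ≤ q x x := hxq
      linarith
    by_cases hKne : K.Nonempty
    · obtain ⟨x₀, hx₀K, hmin⟩ :=
        hKc.exists_isMinOn hKne (continuous_abs.comp hgc).continuousOn
      refine ⟨|g x₀ x₀|, abs_pos.2 (hKg x₀ hx₀K), fun x hxS hlt => ?_⟩
      by_contra hge
      push Not at hge
      have hxK : x ∈ K := ⟨hxS, hge⟩
      have := (isMinOn_iff.1 hmin) x hxK
      simp only [Function.comp_apply] at this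
      linarith
    · refine ⟨1, one_pos, fun x hxS _ => ?_⟩
      by_contra hge
      push Not at hge
      exact hKne ⟨x, hxS, hge⟩
  -- the size bound and the scale
  set B₀ : ℝ := ‖q‖ / η₀ with hB₀def
  have hB₀ : 0 ≤ B₀ := div_nonneg (norm_nonneg q) hη₀.le
  set η : ℝ := min η₀ (m / (2 * (B₀ + 1))) with hηdef
  have hη : 0 < η := lt_min hη₀ (by positivity)
  have hηη₀ : η ≤ η₀ := min_le_left _ _
  have hηB : η * (B₀ + 1) ≤ m / 2 := by
    have h1 : η ≤ m / (2 * (B₀ + 1)) := min_le_right _ _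
    have h2 : 0 < B₀ + 1 := by linarith
    calc η * (B₀ + 1) ≤ m / (2 * (B₀ + 1)) * (B₀ + 1) :=
          mul_le_mul_of_nonneg_right h1 h2.le
      _ = m / 2 := by field_simp
  -- a non-negative value of `q` on the sphere forces `|g| ≥ η₀`
  have hfar : ∀ x ∈ S, 0 ≤ q x x → η₀ ≤ |g x x| := by
    intro x hx hq
    by_contra hlt
    push Not at hlt
    have := hcone x hx hlt
    linarith
  -- the compact pieces
  set Cp : Set V := S ∩ {x | η ≤ g x x} with hCp
  set Cm : Set V := S ∩ {x | g x x ≤ -η} with hCm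
  have hCpc : IsCompact Cp := hS.inter_right (isClosed_le continuous_const hgc)
  have hCmc : IsCompact Cm := hS.inter_right (isClosed_le hgc continuous_const)
  have hφp : ContinuousOn (fun x : V => q x x / g x x) Cp :=
    hqc.continuousOn.div hgc.continuousOn fun x hx => (hη.trans_le hx.2).ne'
  have hφm : ContinuousOn (fun x : V => q x x / g x x) Cm :=
    hqc.continuousOn.div hgc.continuousOn fun x hx => (hx.2.trans_lt (by linarith)).ne
  -- Step 2: the extremal slopes
  -- (a) the upper slope on `Cp`
  have hαex : Cp.Nonempty → ∃ (α : ℝ) (xs : V), xs ∈ Cp ∧ q xs xs = α * g xs xs ∧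
      (∀ x ∈ S, η ≤ g x x → q x x ≤ α * g x x) ∧ (0 ≤ α → α ≤ B₀) := by
    intro hne
    obtain ⟨xs, hxs, hmax⟩ := hCpc.exists_isMaxOn hne hφp
    have hgxs : 0 < g xs xs := hη.trans_le hxs.2
    refine ⟨q xs xs / g xs xs, xs, hxs, (div_mul_cancel₀ _ hgxs.ne').symm, ?_, ?_⟩
    · intro x hx hgx
      have hgpos : 0 < g x x := hη.trans_le hgx
      have h := (isMaxOn_iff.1 hmax) x ⟨hx, hgx⟩
      calc q x x = q x x / g x x * g x x := (div_mul_cancel₀ _ hgpos.ne').symm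
        _ ≤ q xs xs / g xs xs * g x x := mul_le_mul_of_nonneg_right h hgpos.le
    · intro hα0
      have hq0 : 0 ≤ q xs xs := by
        have := mul_nonneg hα0 hgxs.le
        rwa [div_mul_cancel₀ _ hgxs.ne'] at this
      have hg0 : η₀ ≤ g xs xs := by
        have := hfar xs hxs.1 hq0
        rwa [abs_of_pos hgxs] at this
      have hqn : q xs xs ≤ ‖q‖ := finsler_le_opNorm q (hS1 xs hxs.1)
      exact div_le_div₀ (norm_nonneg q) hqn hη₀ hg0
  -- (b) the lower slope on `Cm`
  have hβex : Cm.Nonempty → ∃ (β : ℝ) (ys : V), ys ∈ Cm ∧ q ys ys = β * g ys ys ∧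
      (∀ y ∈ S, g y y ≤ -η → q y y ≤ β * g y y) ∧ (β ≤ 0 → -B₀ ≤ β) := by
    intro hne
    obtain ⟨ys, hys, hmin⟩ := hCmc.exists_isMinOn hne hφm
    have hgys : g ys ys < 0 := hys.2.trans_lt (by linarith)
    refine ⟨q ys ys / g ys ys, ys, hys, (div_mul_cancel₀ _ hgys.ne).symm, ?_, ?_⟩
    · intro y hy hgy
      have hgneg : g y y < 0 := hgy.trans_lt (by linarith)
      have h := (isMinOn_iff.1 hmin) y ⟨hy, hgy⟩
      calc q y y = q y y / g y y * g y y := (div_mul_cancel₀ _ hgneg.ne).symm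
        _ ≤ q ys ys / g ys ys * g y y := mul_le_mul_of_nonpos_right h hgneg.le
    · intro hβ0
      have hq0 : 0 ≤ q ys ys := by
        have := mul_nonneg_of_nonpos_of_nonpos hβ0 hgys.le
        rwa [div_mul_cancel₀ _ hgys.ne] at this
      have hg0 : g ys ys ≤ -η₀ := by
        have := hfar ys hys.1 hq0
        rw [abs_of_neg hgys] at this
        linarith
      have hqn : q ys ys ≤ ‖q‖ := finsler_le_opNorm q (hS1 ys hys.1)
      -- `q/g = -(q/(-g)) ≥ -(‖q‖/η₀)`
      have h1 : q ys ys / (-g ys ys) ≤ ‖q‖ / η₀ :=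
        div_le_div₀ (norm_nonneg q) hqn hη₀ (by linarith)
      have h2 : q ys ys / g ys ys = -(q ys ys / (-g ys ys)) := by
        rw [div_neg, neg_neg]
      rw [h2]
      linarith
  -- Step 3: assemble `α < β` in the four cases and finish with the tail
  by_cases hp : Cp.Nonempty
  · obtain ⟨α, xs, hxs, hqxs, hα, hαB⟩ := hαex hp
    by_cases hmne : Cm.Nonempty
    · obtain ⟨β, ys, hys, hqys, hβ, hβB⟩ := hβex hmne
      have hαβ : α < β := by
        by_contra hle
        push Not at hle
        have hgxs : 0 < g xs xs := hη.trans_le hxs.2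
        have hgys : g ys ys < 0 := hys.2.trans_lt (by linarith)
        refine finsler_pair (q - α • g) g (hneg α) hgxs hgys ?_ ?_
        · have : (q - α • g) xs xs = q xs xs - α * g xs xs := by
            simp only [sub_apply, FunLike.coe_smul, Pi.smul_apply, smul_eq_mul]
          rw [this, hqxs, sub_self]
        · have : (q - α • g) ys ys = q ys ys - α * g ys ys := by
            simp only [sub_apply, FunLike.coe_smul, Pi.smul_apply, smul_eq_mul]
          rw [this, hqys]
          have : (β - α) * g ys ys ≥ 0 := mul_nonneg_of_nonpos_of_nonpos (by linarith) hgys.le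
          linarith
      exact finsler_tail q g hB₀ hη hηη₀ hηB hcone α β hα hαB hβ hβB hαβ
    · -- no lower piece: `β := max 0 α + 1`
      refine finsler_tail q g hB₀ hη hηη₀ hηB hcone α (max 0 α + 1) hα hαB
        (fun y hy hgy => absurd ⟨y, hy, hgy⟩ hmne) (fun h => ?_) ?_
      · linarith [le_max_left 0 α]
      · linarith [le_max_right 0 α]
  · by_cases hmne : Cm.Nonempty
    · obtain ⟨β, ys, hys, hqys, hβ, hβB⟩ := hβex hmne
      -- no upper piece: `α := min 0 β - 1`
      refine finsler_tail q g hB₀ hη hηη₀ hηB hcone (min 0 β - 1) β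
        (fun x hx hgx => absurd ⟨x, hx, hgx⟩ hp) (fun h => ?_) hβ hβB ?_
      · linarith [min_le_left 0 β]
      · linarith [min_le_right 0 β]
    · -- neither piece: `α := -1`, `β := 1`
      exact finsler_tail q g hB₀ hη hηη₀ hηB hcone (-1) 1
        (fun x hx hgx => absurd ⟨x, hx, hgx⟩ hp) (fun h => by linarith)
        (fun y hy hgy => absurd ⟨y, hy, hgy⟩ hmne) (fun h => by linarith) (by norm_num)

end Finsler

end Summit.FinalStateConjecture.FinalStateConjecture.Theorems

end
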